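import Summits.BirchSwinnertonDyer.Rank1Residual.Additive.MinimalGoodOrdinaryField
import Mathlib.FieldTheory.KummerPolynomial
import HarnessLib

/-!
# X3♯(G-ord) / X4♯(G-ord): `ℚ(√p*)` is THE quadratic subfield of `ℚ(ζ_p)` and the minimal (G)-field of the defect-2 cell

HONEST FRAMING (cell `b2b-bsdres`, run/shared/lean/b2b/bsd-rank1-residual/, verbatim in every
file): the goal of the cell is to DELETE the COMBINATION-SHAPED residual classes of the
Birch–Swinnerton-Dyer formula for ALL analytic-rank `≤ 1` elliptic curves over `ℚ` — "full BSD
formula for every rank `≤ 1` curve in class `C`" assembled STRICTLY from published theorems — so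
that the rank-`≤ 1` remainder becomes exactly the CONSTRUCTION-SHAPED classes, which are TYPED
(missing-input `Prop`s), NOT attempted. This is not "finishing BSD". Sub-cell `additive-p2`
(CLASS-OWNERS row "X3/X4 additive — pot. good ordinary / X3♯(G-ord)"), generation 6: research
route; no claim beyond the stated classes; theorems only, no definition, no new named fact;
X3♯(G-ord)/X4♯(G-ord) stay CONSTRUCTION-SHAPED.

WHAT THIS FILE DOES. It closes the loop between the two descriptions of the defect-2 (Kodaira
`I₀*`) cell that the sub-cell has used side by side: the DESCENT FIELD `ℚ(√p*)`,
`p* = (−1)^{(p−1)/2} p`, of the quadratic descent (`QuadraticTwistTypeG.lean`, `GordDescent*.lean`: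
the twist `E^{(p*)}` is good ordinary, `BSD_p(E) ⟺` over-`K` input with `d_K = p*`) and the MINIMAL
(G)-FIELD `F₀ ⊆ ℚ(ζ_p)` of degree `e_E(p)` (gen 5, `MinimalGoodReductionField.lean`:
`TypeG.existsUnique_minimal_field`, `TypeG.forall_hasGoodReductionAt_iff_minimal_le`). In the kernel:

* `finrank_adjoin_eq_two_of_sq_eq_pStar`, `eq_adjoin_of_finrank_eq_two_of_sq_eq_pStar`,
  `mem_iff_two_dvd_finrank_of_sq_eq_pStar` — for `g ∈ ℚ(ζ_p)` with `g² = p*` (the quadratic Gauss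
  sum, gen 0's `exists_sq_eq_pStar`): **`[ℚ(g) : ℚ] = 2`** (`X² − p*` is irreducible: `p*` is not a
  rational square, `forall_sq_ne_pStar`), **`ℚ(g)` is THE subfield of degree `2`** of `ℚ(ζ_p)`, and
  **`g ∈ F ⟺ 2 ∣ [F : ℚ]`** for every subfield `F` (subfields of `ℚ(ζ_p)` are determined by, and
  ordered by divisibility of, their degrees — gen 5).
* `forall_hasGoodReductionAt_adjoin_sqrt_pStar_iff(_eq_two)` — `p ≥ 5`, `W` globally minimal,
  `ord_p j ≥ 0`: **`E` is good above `p` over `ℚ(√p*)` iff `e_E(p) ∣ 2`**, i.e. (for `E` additive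
  at `p`) **iff `e_E(p) = 2`**; `minimal_field_eq_adjoin_sqrt_pStar` — **for `e_E(p) = 2` the
  minimal (G)-field IS `ℚ(√p*)`**; `TypeG.forall_hasGoodReductionAt_iff_sqrt_pStar_mem` — the
  (G)-fields of an `I₀*` pair are exactly the subfields containing `√p*`;
  `sqrt_pStar_mem_of_forall_hasGoodReductionAt_of_two_dvd` /
  `sqrt_pStar_not_mem_minimal_field_of_eq_three` — for EVEN defect (`I₀*, III, III*, II, II*`)
  every (G)-field contains `√p*` (though for `e = 4, 6` the curve is not good over `ℚ(√p*)`), for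
  defect `3` (`IV, IV*`) the minimal (G)-field does not.
* `TypeGOrd.forall_good_and_unitRoot_adjoin_sqrt_pStar`, `typeGOrd_and_eq_two_iff_adjoin_sqrt_pStar`
  — on the additive locus **`TypeGOrd ∧ e_E(p) = 2 ⟺ E_{ℚ(√p*)}` is good ORDINARY above `p`**:
  Delbourgo's standing hypothesis "(G) + potential good ordinary reduction" (Compositio Math. 113
  (1998), Thm 3 / Prop 4 / Main Conjecture) for the `I₀*` cell is read on ONE explicit field.

The companion file `GordDescentField.lean` proves the same statements for an ARBITRARY quadratic
field `K` ramified at `p` (in particular `d_K = p*`, the field of the class theorems), where no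
cyclotomic ambient field is available. Located gap / labels / census UNCHANGED
(HOME/b2b-bsdres-additive-p2/AUDIT-X34-GORD.md): bookkeeping that makes the sub-cell's two
descriptions of the `I₀*` cell provably the same; it moves no pair.

References: K. Ireland, M. Rosen, *A Classical Introduction to Modern Number Theory*, Prop. 6.3.2
(`g² = (−1)^{(p−1)/2} p`); L. C. Washington, *Introduction to Cyclotomic Fields*, Ch. 2 (subfields
of `ℚ(ζ_p)`; the unique quadratic subfield is `ℚ(√p*)`); D. Delbourgo, Compositio Math. 113 (1998)
§1.3 (`Φ_p`, `d`), §1.5 (G); J.-P. Serre, Invent. Math. 15 (1972) §5.6; J. H. Silverman, *AEC*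
VII.5.1, VII.5.4.
-/

noncomputable section

open scoped Classical NumberField

open WeierstrassCurve IsDedekindDomain IsDedekindDomain.HeightOneSpectrum NumberField Polynomial
  Rat.HeightOneSpectrum Literature.NumberTheory.EllipticCurves
  Literature.NumberTheory.EllipticCurves.Rank1Residual

namespace Summit.BirchSwinnertonDyer.Rank1Residual.Additive

/-! ### `ℚ(√p*)` is the quadratic subfield of `ℚ(ζ_p)` -/

section QuadraticSubfield

variable (p : ℕ) [hp : Fact p.Prime] {L : Type} [Field L] [NumberField L]
  [hcyc : IsCyclotomicExtension {p} ℚ L]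

/-- `p* = (−1)^{⌊p/2⌋} p` is not a square in `ℚ`: `ord_p (q²) = 2 ord_p q` is even while
`ord_p (±p) = 1`. -/
theorem forall_sq_ne_pStar (q : ℚ) : q ^ 2 ≠ (-1 : ℚ) ^ (p / 2) * p := by
  intro hq
  have hp1 : 1 < p := hp.out.one_lt
  have h1 : padicValRat p (q ^ 2) = 2 * padicValRat p q := padicValRat.pow (p := p) q
  have h2 : padicValRat p ((-1 : ℚ) ^ (p / 2) * p) = 1 := by
    rw [padicValRat.mul (pow_ne_zero _ (by norm_num)) (by exact_mod_cast hp.out.ne_zero),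
      padicValRat.pow (p := p) (-1 : ℚ), padicValRat.neg, padicValRat.one,
      mul_zero, zero_add, padicValRat.self hp1]
  rw [hq, h2] at h1
  omega

omit hcyc in
/-- **`[ℚ(√p*) : ℚ] = 2`**: for `g ∈ L` with `g² = p*`, the minimal polynomial of `g` over `ℚ` is
`X² − p*` (irreducible: `p*` is not a rational square; Mathlib `X_pow_sub_C_irreducible_of_prime`),
so `ℚ(g) = ℚ⟮g⟯` has degree `2` (`IntermediateField.adjoin.finrank`). -/
theorem finrank_adjoin_eq_two_of_sq_eq_pStar {g : L} (hg : g ^ 2 = (-1 : L) ^ (p / 2) * p) :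
    Module.finrank ℚ (IntermediateField.adjoin ℚ {g}) = 2 := by
  set d : ℚ := (-1 : ℚ) ^ (p / 2) * p with hd
  have hgd : g ^ 2 = algebraMap ℚ L d := by
    rw [hg, hd, map_mul, map_pow, map_neg, map_one, map_natCast]
  have hirr : Irreducible (X ^ 2 - C d : ℚ[X]) :=
    X_pow_sub_C_irreducible_of_prime Nat.prime_two (fun b hb => forall_sq_ne_pStar p b (by rw [hb]))
  have hmonic : (X ^ 2 - C d : ℚ[X]).Monic := monic_X_pow_sub_C d two_ne_zero
  have haeval : aeval g (X ^ 2 - C d : ℚ[X]) = 0 := by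
    simp only [map_sub, map_pow, aeval_X, aeval_C, hgd, sub_self]
  have hint : IsIntegral ℚ g := ⟨X ^ 2 - C d, hmonic, by rwa [aeval_def] at haeval⟩
  have hmin : minpoly ℚ g = X ^ 2 - C d :=
    (minpoly.eq_of_irreducible_of_monic hirr haeval hmonic).symm
  rw [IntermediateField.adjoin.finrank hint, hmin, natDegree_X_pow_sub_C]

include hcyc in
/-- **`ℚ(√p*)` is THE quadratic subfield of `ℚ(ζ_p)`**: every subfield of degree `2` of a `p`-th
cyclotomic field equals `ℚ(g)`, `g² = p*` (a subfield of `ℚ(ζ_p)` is determined by its degree,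
`intermediateField_eq_of_finrank_eq`). Washington, *Introduction to Cyclotomic Fields*, Ch. 2;
Ireland–Rosen Prop. 6.3.2. -/
theorem eq_adjoin_of_finrank_eq_two_of_sq_eq_pStar {g : L} (hg : g ^ 2 = (-1 : L) ^ (p / 2) * p)
    (F : IntermediateField ℚ L) (hF : Module.finrank ℚ F = 2) :
    F = IntermediateField.adjoin ℚ {g} :=
  intermediateField_eq_of_finrank_eq p F _ (hF.trans (finrank_adjoin_eq_two_of_sq_eq_pStar p hg).symm)

include hcyc in
/-- **`√p* ∈ F` iff `[F : ℚ]` is even**, for every subfield `F ⊆ ℚ(ζ_p)` (`p` odd): subfields of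
`ℚ(ζ_p)` are ordered by divisibility of degrees (`intermediateField_le_iff_finrank_dvd`) and
`ℚ(g) ≤ F ↔ g ∈ F`. -/
theorem mem_iff_two_dvd_finrank_of_sq_eq_pStar {g : L} (hg : g ^ 2 = (-1 : L) ^ (p / 2) * p)
    (F : IntermediateField ℚ L) : g ∈ F ↔ 2 ∣ Module.finrank ℚ F := by
  rw [← IntermediateField.adjoin_simple_le_iff, intermediateField_le_iff_finrank_dvd p _ F,
    finrank_adjoin_eq_two_of_sq_eq_pStar p hg]

include hcyc in
/-- For `p` odd the quadratic subfield exists: there is `g ∈ L` with `g² = p*` (gen 0's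
`exists_sq_eq_pStar`, the quadratic Gauss sum) and `[ℚ(g) : ℚ] = 2`. -/
theorem exists_sq_eq_pStar_and_finrank_eq_two (hp2 : p ≠ 2) :
    ∃ g : L, g ^ 2 = (-1 : L) ^ (p / 2) * p ∧
      Module.finrank ℚ (IntermediateField.adjoin ℚ {g}) = 2 := by
  obtain ⟨g, hg⟩ := exists_sq_eq_pStar p L hp2
  exact ⟨g, hg, finrank_adjoin_eq_two_of_sq_eq_pStar p hg⟩

end QuadraticSubfield

/-! ### The curve over `ℚ(√p*) ⊆ ℚ(ζ_p)`: good above `p` iff defect `2`; the minimal (G)-field of an `I₀*` pair -/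

section OverSqrt

variable (W : WeierstrassCurve ℚ) [W.IsElliptic] [W.IsGloballyMinimal] (p : ℕ) [hp : Fact p.Prime]
  {L : Type} [Field L] [NumberField L] [hcyc : IsCyclotomicExtension {p} ℚ L]

/-- At an ADDITIVE potentially good `p ≥ 5`, `e_E(p) ∣ 2 ↔ e_E(p) = 2` (`e_E(p) ≠ 1`,
`semistabilityIndex_ne_one_of_addv`). -/
theorem semistabilityIndex_dvd_two_iff_eq_two_of_addv (hp5 : 5 ≤ p) (hadd : Addv W p)
    (hj : 0 ≤ padicValRat p W.j) : semistabilityIndex W p ∣ 2 ↔ semistabilityIndex W p = 2 := by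
  refine ⟨fun h => ?_, fun h => by rw [h]⟩
  have hne1 := semistabilityIndex_ne_one_of_addv W p hp5 hadd hj
  have hle : semistabilityIndex W p ≤ 2 := Nat.le_of_dvd two_pos h
  interval_cases hsi : semistabilityIndex W p
  · have h12 := semistabilityIndex_dvd_twelve W p
    rw [hsi] at h12
    norm_num at h12
  · exact absurd rfl hne1
  · rfl

include hcyc in
/-- **Over `ℚ(√p*) ⊆ ℚ(ζ_p)`, `E` is good above `p` iff `e_E(p) ∣ 2`** (`p ≥ 5`, `ord_p j ≥ 0`, `W`
globally minimal; `g² = p*`): gen 5's `forall_hasGoodReductionAt_baseChange_iff_semistabilityIndex_dvd_finrank`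
with `[ℚ(√p*) : ℚ] = 2`. So among potentially good pairs exactly the good (`e = 1`) and the
Kodaira-`I₀*` (`e = 2`) ones are good over `ℚ(√p*)`. -/
theorem forall_hasGoodReductionAt_adjoin_sqrt_pStar_iff (hp5 : 5 ≤ p) (hj : 0 ≤ padicValRat p W.j)
    {g : L} (hg : g ^ 2 = (-1 : L) ^ (p / 2) * p) :
    (∀ w : HeightOneSpectrum (𝓞 (IntermediateField.adjoin ℚ {g})),
        (p : 𝓞 (IntermediateField.adjoin ℚ {g})) ∈ w.asIdeal →
          (W.baseChange (IntermediateField.adjoin ℚ {g})).HasGoodReductionAt w) ↔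
      semistabilityIndex W p ∣ 2 := by
  rw [forall_hasGoodReductionAt_baseChange_iff_semistabilityIndex_dvd_finrank W p _ hp5 hj,
    finrank_adjoin_eq_two_of_sq_eq_pStar p hg]

include hcyc in
/-- **An ADDITIVE potentially good pair becomes good over `ℚ(√p*)` iff it is of defect `2`**
(Kodaira type `I₀*`; `p ≥ 5`, `W` globally minimal). -/
theorem forall_hasGoodReductionAt_adjoin_sqrt_pStar_iff_eq_two (hp5 : 5 ≤ p) (hadd : Addv W p)
    (hj : 0 ≤ padicValRat p W.j) {g : L} (hg : g ^ 2 = (-1 : L) ^ (p / 2) * p) :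
    (∀ w : HeightOneSpectrum (𝓞 (IntermediateField.adjoin ℚ {g})),
        (p : 𝓞 (IntermediateField.adjoin ℚ {g})) ∈ w.asIdeal →
          (W.baseChange (IntermediateField.adjoin ℚ {g})).HasGoodReductionAt w) ↔
      semistabilityIndex W p = 2 := by
  rw [forall_hasGoodReductionAt_adjoin_sqrt_pStar_iff W p hp5 hj hg,
    semistabilityIndex_dvd_two_iff_eq_two_of_addv W p hp5 hadd hj]

omit [W.IsElliptic] in
include hcyc in
/-- **The minimal (G)-field of a defect-2 pair is `ℚ(√p*)`** (`p ≥ 5`, `W` globally minimal): if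
`e_E(p) = 2`, the subfield `F₀ ⊆ ℚ(ζ_p)` of degree `e_E(p)` — the minimal (G)-field of
`TypeG.existsUnique_minimal_field` / `TypeG.forall_hasGoodReductionAt_iff_minimal_le` — is `ℚ(g)`,
`g² = p*`. This is the field over which the quadratic descent of `GordDescent*.lean` runs. -/
theorem minimal_field_eq_adjoin_sqrt_pStar (he : semistabilityIndex W p = 2)
    (F₀ : IntermediateField ℚ L) (hF₀ : Module.finrank ℚ F₀ = semistabilityIndex W p)
    {g : L} (hg : g ^ 2 = (-1 : L) ^ (p / 2) * p) : F₀ = IntermediateField.adjoin ℚ {g} :=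
  eq_adjoin_of_finrank_eq_two_of_sq_eq_pStar p hg F₀ (hF₀.trans he)

include hcyc in
/-- **For a defect-2 pair of type (G), the (G)-fields in `ℚ(ζ_p)` are exactly the subfields
containing `√p*`** (`p ≥ 5`, `W` globally minimal): `E_F` good above `p` iff `g ∈ F`. -/
theorem TypeG.forall_hasGoodReductionAt_iff_sqrt_pStar_mem (hp5 : 5 ≤ p) (hG : TypeG W p)
    (he : semistabilityIndex W p = 2) {g : L} (hg : g ^ 2 = (-1 : L) ^ (p / 2) * p)
    (F : IntermediateField ℚ L) :
    (∀ w : HeightOneSpectrum (𝓞 F), (p : 𝓞 F) ∈ w.asIdeal →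
        (W.baseChange F).HasGoodReductionAt w) ↔ g ∈ F := by
  rw [TypeG.forall_hasGoodReductionAt_iff_minimal_le W p L hp5 hG (IntermediateField.adjoin ℚ {g})
      ((finrank_adjoin_eq_two_of_sq_eq_pStar p hg).trans he.symm) F,
    IntermediateField.adjoin_simple_le_iff]

include hcyc in
/-- **Every (G)-field of a pair of EVEN defect contains `√p*`** (`p ≥ 5`, `W` globally minimal):
for `e_E(p) ∈ {2, 4, 6}` (Kodaira `I₀*`, `III`, `III*`, `II`, `II*`) and any subfield `F ⊆ ℚ(ζ_p)`
over which `E` is good above `p`, `g ∈ F` — because `e_E(p) ∣ [F : ℚ]`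
(`semistabilityIndex_dvd_finrank_of_forall_hasGoodReductionAt`) and `g ∈ F ↔ 2 ∣ [F : ℚ]`. (For
`e_E(p) = 4, 6` the curve is nevertheless NOT good over `ℚ(√p*)` itself:
`forall_hasGoodReductionAt_adjoin_sqrt_pStar_iff_eq_two`.) -/
theorem sqrt_pStar_mem_of_forall_hasGoodReductionAt_of_two_dvd
    (h2 : 2 ∣ semistabilityIndex W p) {g : L} (hg : g ^ 2 = (-1 : L) ^ (p / 2) * p)
    (F : IntermediateField ℚ L)
    (hF : ∀ w : HeightOneSpectrum (𝓞 F), (p : 𝓞 F) ∈ w.asIdeal →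
      (W.baseChange F).HasGoodReductionAt w) : g ∈ F :=
  (mem_iff_two_dvd_finrank_of_sq_eq_pStar p hg F).mpr
    (h2.trans (semistabilityIndex_dvd_finrank_of_forall_hasGoodReductionAt W p F hF))

omit [W.IsElliptic] in
include hcyc in
/-- **The minimal (G)-field of a defect-3 pair does NOT contain `√p*`** (Kodaira `IV`, `IV*` with
`3 ∣ p − 1`): `[F₀ : ℚ] = 3` is odd. -/
theorem sqrt_pStar_not_mem_minimal_field_of_eq_three (he : semistabilityIndex W p = 3)
    (F₀ : IntermediateField ℚ L) (hF₀ : Module.finrank ℚ F₀ = semistabilityIndex W p)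
    {g : L} (hg : g ^ 2 = (-1 : L) ^ (p / 2) * p) : g ∉ F₀ := by
  rw [mem_iff_two_dvd_finrank_of_sq_eq_pStar p hg F₀, hF₀, he]
  norm_num

include hcyc in
/-- **A (G)-ordinary defect-2 pair is GOOD ORDINARY above `p` over `ℚ(√p*) ⊆ ℚ(ζ_p)`** (`p ≥ 5`,
`E` additive at `p`, `W` globally minimal): the standing hypothesis of Delbourgo's Thm 3 / Prop 4 /
Main Conjecture (G) read on the descent field (gen 5's
`TypeGOrd.forall_good_and_unitRoot_iff_minimal_le` at `F = F₀ = ℚ(g)`). -/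
theorem TypeGOrd.forall_good_and_unitRoot_adjoin_sqrt_pStar (hp5 : 5 ≤ p) (hG : TypeGOrd W p)
    (hadd : Addv W p) (he : semistabilityIndex W p = 2) {g : L}
    (hg : g ^ 2 = (-1 : L) ^ (p / 2) * p) :
    ∀ w : HeightOneSpectrum (𝓞 (IntermediateField.adjoin ℚ {g})),
      (p : 𝓞 (IntermediateField.adjoin ℚ {g})) ∈ w.asIdeal →
        (W.baseChange (IntermediateField.adjoin ℚ {g})).HasGoodReductionAt w ∧
          (W.baseChange (IntermediateField.adjoin ℚ {g})).HasUnitRootAt w :=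
  (TypeGOrd.forall_good_and_unitRoot_iff_minimal_le W p L hp5 hG hadd
    (IntermediateField.adjoin ℚ {g}) ((finrank_adjoin_eq_two_of_sq_eq_pStar p hg).trans he.symm)
    (IntermediateField.adjoin ℚ {g})).mpr le_rfl

include hcyc in
/-- Conversely **good ordinary above `p` over `ℚ(√p*)` gives (G)-ordinary with defect `2`** for an
additive pair (`p ≥ 5`, `W` globally minimal): so on the additive locus
`TypeGOrd ∧ e_E(p) = 2 ⟺ E_{ℚ(√p*)}` good ordinary above `p` — Delbourgo's (G)-ordinary `I₀*` cell
is read on ONE field. -/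
theorem typeGOrd_and_eq_two_iff_adjoin_sqrt_pStar (hp5 : 5 ≤ p) (hadd : Addv W p) {g : L}
    (hg : g ^ 2 = (-1 : L) ^ (p / 2) * p) :
    (TypeGOrd W p ∧ semistabilityIndex W p = 2) ↔
      ∀ w : HeightOneSpectrum (𝓞 (IntermediateField.adjoin ℚ {g})),
        (p : 𝓞 (IntermediateField.adjoin ℚ {g})) ∈ w.asIdeal →
          (W.baseChange (IntermediateField.adjoin ℚ {g})).HasGoodReductionAt w ∧
            (W.baseChange (IntermediateField.adjoin ℚ {g})).HasUnitRootAt w := by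
  constructor
  · rintro ⟨hG, he⟩
    exact TypeGOrd.forall_good_and_unitRoot_adjoin_sqrt_pStar W p hp5 hG hadd he hg
  · intro h
    have hG : TypeGOrd W p := ⟨L, inferInstance, inferInstance, hcyc, _, h⟩
    refine ⟨hG, ?_⟩
    exact (forall_hasGoodReductionAt_adjoin_sqrt_pStar_iff_eq_two W p hp5 hadd
      (padicValRat_j_nonneg_of_typeGOrd W p hG) hg).mp (fun w hw => (h w hw).1)

end OverSqrt

end Summit.BirchSwinnertonDyer.Rank1Residual.Additive

end
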